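import Summits.CriticalPhenomena.PercolationContinuityZ3.Theorems.PercNearOneGluingNoHeavyLowerTailSahiSymCubeOrbit

/-!
# Sahi's `C_n` on the cube `{0,1}^m` by coloured antichains modulo the symmetries of the cube, IIb: restricted-growth relabelling and the
# CANONICAL REPRESENTATIVE of an orbit

Support file (cell `prim-sahi`, seat `prim-sahi-typer` gen 29; `--supports stmt-CriticalPhenomena-4575`).  Pure proofs; standard axioms, no
`sorry`.  Parts I, IIa: …`SahiSymCubeCheck`, …`SahiSymCubeOrbit`.

* restricted growth: `rgsAux_eq_map` (the relabelling `rgs` IS a relabelling, by the index in the first-occurrence list `folAux`), `rgs_map`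
  (it only sees the pattern: invariant under maps injective on the values), `rgOK_rgsAux` (its output is a restricted-growth list whose final
  colour count is the number of distinct values);
* `pairKey` — the orbit key `(keyE (σ • E), rgs (colour list pulled back along σ⁻¹))` in the lexicographic product order, and
  **`exists_canonical`**: a minimiser `σ` over the (finite) group gives a canonical point set (`isCanonE_of_min`) on which the relabelled
  transported colouring is canonical for the stabiliser test of the checker (`isCanonC_of_min`). [this work]
-/

namespace Summit.CriticalPhenomena.PercolationContinuityZ3.Theorems.SahiSymCube

open Finset OneCutCert CovTransferCert SahiC3Cube NCopyCert

/-! ## Restricted growth -/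

/-- The values in order of first occurrence, continuing `seen`. [this work] -/
def folAux : List ℕ → List ℕ → List ℕ
  | seen, [] => seen
  | seen, a :: l => if a ∈ seen then folAux seen l else folAux (seen ++ [a]) l

/-- `folAux` extends `seen`. [this work] -/
theorem folAux_eq_append (seen l : List ℕ) : ∃ t, folAux seen l = seen ++ t := by
  induction l generalizing seen with
  | nil => exact ⟨[], by simp [folAux]⟩
  | cons a l ih =>
    unfold folAux
    split_ifs with h
    · exact ih seen
    · obtain ⟨t, ht⟩ := ih (seen ++ [a])
      exact ⟨[a] ++ t, by rw [ht, List.append_assoc]⟩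

/-- `seen` is no longer than `folAux seen l`. [this work] -/
theorem length_le_length_folAux (seen l : List ℕ) : seen.length ≤ (folAux seen l).length := by
  obtain ⟨t, ht⟩ := folAux_eq_append seen l
  rw [ht, List.length_append]; omega

/-- Members of `folAux`. [this work] -/
theorem mem_folAux {seen l : List ℕ} {b : ℕ} : b ∈ folAux seen l ↔ b ∈ seen ∨ b ∈ l := by
  induction l generalizing seen with
  | nil => simp [folAux]
  | cons a l ih =>
    unfold folAux
    split_ifs with h <;> rw [ih]
    · constructor
      · rintro (hb | hb)
        · exact Or.inl hb
        · exact Or.inr (List.mem_cons_of_mem _ hb)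
      · rintro (hb | hb)
        · exact Or.inl hb
        · rcases List.mem_cons.1 hb with rfl | hb
          · exact Or.inl h
          · exact Or.inr hb
    · rw [List.mem_append, List.mem_singleton, List.mem_cons, or_assoc]

/-- `folAux` has no duplicates if `seen` has none. [this work] -/
theorem folAux_nodup {seen : List ℕ} (l : List ℕ) (h : seen.Nodup) : (folAux seen l).Nodup := by
  induction l generalizing seen with
  | nil => exact h
  | cons a l ih =>
    unfold folAux
    split_ifs with ha
    · exact ih h
    · refine ih (List.nodup_append.2 ⟨h, List.nodup_singleton a, ?_⟩)
      intro b hb c hc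
      rw [List.mem_singleton] at hc
      subst hc
      rintro rfl
      exact ha hb

/-- **The relabelling is a relabelling**: `rgsAux seen l = l.map (index in folAux seen l)`. [this work] -/
theorem rgsAux_eq_map (seen l : List ℕ) : rgsAux seen l = l.map fun a => (folAux seen l).idxOf a := by
  induction l generalizing seen with
  | nil => rfl
  | cons a l ih =>
    unfold rgsAux folAux
    rw [List.map_cons]
    split_ifs with ha
    · rw [ih seen]
      congr 1
      obtain ⟨t, ht⟩ := folAux_eq_append seen l
      rw [ht, List.idxOf_append_of_mem ha]
    · rw [ih (seen ++ [a])]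
      congr 1
      obtain ⟨t, ht⟩ := folAux_eq_append (seen ++ [a]) l
      rw [ht, List.idxOf_append_of_mem (List.mem_append_right _ (List.mem_singleton_self a)),
        List.idxOf_append_of_notMem ha]
      simp

/-- Length of the relabelled list. [this work] -/
theorem length_rgsAux (seen l : List ℕ) : (rgsAux seen l).length = l.length := by
  rw [rgsAux_eq_map, List.length_map]

/-- `idxOf` through an injective map. [this work] -/
theorem idxOf_map_of_injOn {f : ℕ → ℕ} {S : Set ℕ} (hf : Set.InjOn f S) :
    ∀ (l : List ℕ) (a : ℕ), (∀ b ∈ l, b ∈ S) → a ∈ S → (l.map f).idxOf (f a) = l.idxOf a := by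
  intro l
  induction l with
  | nil => intro a _ _; rfl
  | cons b l ih =>
    intro a hl ha
    rw [List.map_cons, List.idxOf_cons, List.idxOf_cons,
      ih a (fun c hc => hl c (List.mem_cons_of_mem _ hc)) ha]
    have : (f b == f a) = (b == a) := by
      by_cases hba : b = a
      · subst hba; simp
      · have : f b ≠ f a := fun h => hba (hf (hl b List.mem_cons_self) ha h)
        simp [hba, this]
    rw [this]

/-- **The relabelling only sees the pattern**: it is invariant under maps injective on the values. [this work] -/
theorem rgsAux_map {f : ℕ → ℕ} {S : Set ℕ} (hf : Set.InjOn f S) :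
    ∀ (l seen : List ℕ), (∀ b ∈ seen, b ∈ S) → (∀ b ∈ l, b ∈ S) → rgsAux (seen.map f) (l.map f) = rgsAux seen l := by
  intro l
  induction l with
  | nil => intro seen _ _; rfl
  | cons a l ih =>
    intro seen hseen hl
    have ha : a ∈ S := hl a List.mem_cons_self
    have hl' : ∀ b ∈ l, b ∈ S := fun b hb => hl b (List.mem_cons_of_mem _ hb)
    have hmem : (f a ∈ seen.map f) ↔ a ∈ seen := by
      rw [List.mem_map]
      constructor
      · rintro ⟨b, hb, hfb⟩
        rwa [← hf (hseen b hb) ha hfb]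
      · intro h; exact ⟨a, h, rfl⟩
    rw [List.map_cons]
    unfold rgsAux
    by_cases has : a ∈ seen
    · rw [if_pos (hmem.2 has), if_pos has, idxOf_map_of_injOn hf seen a hseen ha, ih seen hseen hl']
    · rw [if_neg (fun h => has (hmem.1 h)), if_neg has, List.length_map]
      have e : seen.map f ++ [f a] = (seen ++ [a]).map f := by simp
      have hseen' : ∀ b ∈ seen ++ [a], b ∈ S := by
        intro b hb
        rcases List.mem_append.1 hb with hb | hb
        · exact hseen b hb
        · rw [List.mem_singleton] at hb; subst hb; exact ha
      rw [e, ih (seen ++ [a]) hseen' hl']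

/-- `rgs` is invariant under maps injective on the values. [this work] -/
theorem rgs_map {f : ℕ → ℕ} {S : Set ℕ} (hf : Set.InjOn f S) {l : List ℕ} (hl : ∀ b ∈ l, b ∈ S) : rgs (l.map f) = rgs l := by
  unfold rgs
  have := rgsAux_map hf l [] (fun _ h => by simp at h) hl
  rwa [List.map_nil] at this

/-- **Relabelled lists are restricted-growth lists**, with the final colour count the number of distinct values. [this work] -/
theorem rgOK_rgsAux {n : ℕ} : ∀ (l seen : List ℕ), seen.Nodup → (folAux seen l).length ≤ n →
    rgOK n seen.length (rgsAux seen l) = true ∧ ncFin seen.length (rgsAux seen l) = (folAux seen l).length := by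
  intro l
  induction l with
  | nil => intro seen _ _; exact ⟨rfl, rfl⟩
  | cons a l ih =>
    intro seen hnd hn
    unfold rgsAux folAux
    unfold folAux at hn
    by_cases ha : a ∈ seen
    · rw [if_pos ha] at hn ⊢
      rw [if_pos ha]
      have hidx : seen.idxOf a < seen.length := List.idxOf_lt_length_of_mem ha
      have hle := length_le_length_folAux seen l
      obtain ⟨h1, h2⟩ := ih seen hnd hn
      have hmax : max seen.length (seen.idxOf a + 1) = seen.length := max_eq_left hidx
      unfold rgOK ncFin
      rw [hmax]
      refine ⟨?_, h2⟩
      simp only [Bool.and_eq_true, decide_eq_true_eq]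
      exact ⟨⟨le_of_lt hidx, by omega⟩, h1⟩
    · rw [if_neg ha] at hn ⊢
      rw [if_neg ha]
      have hnd' : (seen ++ [a]).Nodup := by
        refine List.nodup_append.2 ⟨hnd, List.nodup_singleton a, ?_⟩
        intro b hb c hc; rw [List.mem_singleton] at hc; subst hc; rintro rfl; exact ha hb
      have hle := length_le_length_folAux (seen ++ [a]) l
      have hlen' : (seen ++ [a]).length = seen.length + 1 := by simp
      obtain ⟨h1, h2⟩ := ih (seen ++ [a]) hnd' hn
      rw [hlen'] at h1 h2 hle
      have hmax : max seen.length (seen.length + 1) = seen.length + 1 := max_eq_right (Nat.le_succ _)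
      unfold rgOK ncFin
      rw [hmax]
      refine ⟨?_, h2⟩
      simp only [Bool.and_eq_true, decide_eq_true_eq]
      exact ⟨⟨le_rfl, by omega⟩, h1⟩

/-! ## Canonical representatives -/

/-- The ORBIT KEY of a coloured point set at `σ`: the key of the image and the relabelled colour list pulled back along `σ⁻¹`
(lexicographic pairs). [this work] -/
def pairKey (m : ℕ) (E : Finset ℕ) (d : ℕ → ℕ) (σ : Equiv.Perm (Fin m)) : Lex (List ℕ × List ℕ) :=
  toLex (keyE (imgE m σ E), rgs ((keyE (imgE m σ E)).map fun x => d (actP m σ⁻¹ x)))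

/-- The image under a minimiser of the orbit key is a canonical point set. [this work] -/
theorem isCanonE_of_min {m : ℕ} {E : Finset ℕ} {d : ℕ → ℕ} {σ : Equiv.Perm (Fin m)}
    (hmin : ∀ τ : Equiv.Perm (Fin m), pairKey m E d σ ≤ pairKey m E d τ) : isCanonE m (imgE m σ E) = true := by
  unfold isCanonE
  rw [List.all_eq_true]
  intro p hp
  obtain ⟨τ, hτ⟩ := exists_perm_of_mem_permsL hp
  have himg : imgL m p (imgE m σ E) = imgE m (τ * σ) E := by
    unfold imgL
    rw [image_congr (g := actP m τ) fun x _ => hτ x]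
    exact imgE_mul σ τ E
  rw [himg, Bool.not_eq_true', decide_eq_false_iff_not]
  intro hlt
  have h := hmin (τ * σ)
  unfold pairKey at h
  rw [Prod.Lex.toLex_le_toLex] at h
  dsimp only at h
  rcases h with h | ⟨h, -⟩
  · exact lt_asymm h hlt
  · rw [h] at hlt; exact lt_irrefl _ hlt

/-- Reading a colour list at the position of a member. [this work] -/
theorem getD_map_idxOf {P : List ℕ} (g : ℕ → ℕ) {y : ℕ} (hy : y ∈ P) : (P.map g).getD (P.idxOf y) 0 = g y := by
  have hlt : P.idxOf y < P.length := List.idxOf_lt_length_of_mem hy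
  rw [List.getD_eq_getElem _ _ (by rw [List.length_map]; exact hlt), List.getElem_map, List.getElem_idxOf hlt]

/-- **The relabelled pull-back under a minimiser is a canonical colour list.** [this work] -/
theorem isCanonC_of_min {m : ℕ} {E : Finset ℕ} {d : ℕ → ℕ} {σ : Equiv.Perm (Fin m)}
    (hmin : ∀ τ : Equiv.Perm (Fin m), pairKey m E d σ ≤ pairKey m E d τ) :
    isCanonC (posPerms m (imgE m σ E)) (rgs ((keyE (imgE m σ E)).map fun x => d (actP m σ⁻¹ x))) = true := by
  set E' := imgE m σ E with hE'
  set P := keyE E'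
  set d' : ℕ → ℕ := fun x => d (actP m σ⁻¹ x) with hd'
  have hE'lt : ∀ x ∈ E', x < 2 ^ m := imgE_lt σ E
  unfold isCanonC posPerms
  rw [List.all_eq_true]
  intro pp hpp
  rw [List.mem_map] at hpp
  obtain ⟨p, hp, rfl⟩ := hpp
  rw [List.mem_filter] at hp
  obtain ⟨hp, hfix⟩ := hp
  rw [decide_eq_true_eq] at hfix
  obtain ⟨τ, hτ⟩ := exists_perm_of_mem_permsL hp
  have hfix' : imgE m τ E' = E' := by
    have e : imgE m τ E' = imgL m p E' := by unfold imgL imgE; exact (image_congr fun x _ => hτ x).symm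
    rw [e, hfix]
  rw [Bool.not_eq_true', decide_eq_false_iff_not, List.map_map]
  -- the relabelling `φ` of `rgs`
  set l := P.map d' with hl
  set φ : ℕ → ℕ := fun a => (folAux [] l).idxOf a with hφ
  have hrgs : rgs l = P.map (φ ∘ d') := by
    show rgsAux [] l = _
    rw [rgsAux_eq_map, hl, List.map_map]
  have hφinj : Set.InjOn φ {a | a ∈ folAux [] l} := by
    intro a ha b hb hab
    simp only [Set.mem_setOf_eq] at ha hb
    have h1 := List.getElem_idxOf (List.idxOf_lt_length_of_mem ha)
    have h2 := List.getElem_idxOf (List.idxOf_lt_length_of_mem hb)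
    simp only [hφ] at hab
    rw [← h1, ← h2]
    simp only [hab]
  -- the pulled-back list is the colour list of `φ ∘ d' ∘ τ`
  have hpull : P.map ((fun k => (rgs l).getD k 0) ∘ fun x => P.idxOf (actL m p x)) = (P.map fun x => d' (actP m τ x)).map φ := by
    rw [List.map_map]
    refine List.map_congr_left fun x hx => ?_
    have hx' : x ∈ E' := mem_keyE.1 hx
    have hy : actP m τ x ∈ P := mem_keyE.2 (actP_mem_of_imgE_eq hfix' hx')
    simp only [Function.comp_apply, hτ x, hrgs]
    exact getD_map_idxOf (φ ∘ d') hy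
  have hvals : ∀ b ∈ P.map (fun x => d' (actP m τ x)), b ∈ {a | a ∈ folAux [] l} := by
    intro b hb
    rw [List.mem_map] at hb
    obtain ⟨x, hx, rfl⟩ := hb
    simp only [Set.mem_setOf_eq, mem_folAux, List.not_mem_nil, false_or, hl, List.mem_map]
    exact ⟨actP m τ x, mem_keyE.2 (actP_mem_of_imgE_eq hfix' (mem_keyE.1 hx)), rfl⟩
  rw [hpull, rgs_map hφinj hvals]
  -- it is the second component of the orbit key at `τ⁻¹ σ`
  have hkey : keyE (imgE m (τ⁻¹ * σ) E) = P := by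
    rw [← imgE_mul, ← hE', imgE_inv_of_imgE_eq hE'lt hfix']
  have hsnd : (P.map fun x => d' (actP m τ x)) = (keyE (imgE m (τ⁻¹ * σ) E)).map fun x => d (actP m (τ⁻¹ * σ)⁻¹ x) := by
    rw [hkey]
    refine List.map_congr_left fun x _ => ?_
    simp only [hd', actP_mul, mul_inv_rev, inv_inv]
  rw [hsnd, hkey]
  intro hlt
  have h := hmin (τ⁻¹ * σ)
  unfold pairKey at h
  rw [Prod.Lex.toLex_le_toLex, hkey] at h
  dsimp only at h
  rcases h with h | ⟨-, h⟩
  · exact lt_irrefl _ h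
  · exact not_lt.2 h hlt

/-- **CANONICAL REPRESENTATIVES**: every coloured point set has an image under a coordinate permutation that is a canonical point set on
which the relabelled transported colouring is a canonical colour list (a minimiser of the orbit key). [this work] -/
theorem exists_canonical (m : ℕ) (E : Finset ℕ) (d : ℕ → ℕ) :
    ∃ σ : Equiv.Perm (Fin m), isCanonE m (imgE m σ E) = true ∧
      isCanonC (posPerms m (imgE m σ E)) (rgs ((keyE (imgE m σ E)).map fun x => d (actP m σ⁻¹ x))) = true := by
  obtain ⟨σ, -, hmin⟩ := exists_min_image univ (pairKey m E d) univ_nonempty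
  exact ⟨σ, isCanonE_of_min fun τ => hmin τ (mem_univ τ), isCanonC_of_min fun τ => hmin τ (mem_univ τ)⟩

end Summit.CriticalPhenomena.PercolationContinuityZ3.Theorems.SahiSymCube
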